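import Summits.AtomisticToContinuum.Crystallization.Theorems.OverbindingBudgetAffineCompressedCutBoxBounds

/-!
# Overbinding budget, R4 «LR(r₁)» part X — LEVELS: down-cap consistency a posteriori (`pair_reverse`) and the caps of a run

Route `OverbindingBudget`, crux `RobustDefectLimitWindows`, open leaf `NearFieldSlackMinSecond 12 (1/25)` ⟸ 79K ⟸ LR(r₁) (memos NODE-g80-LayerRigidity
§2, NODE-g81-Budget §3–§4, NODE-g81-Patch §2).  The climbing run of «RunBox»/«BoxBounds» records, at every level `m`, the UP-CAPS of the level's copy
(`capv sg ε δ ∈ Cs m`, the caps used to climb); the layer-rigidity READING also needs the DOWN-CAPS of the next level's copy — that the copy `Cs (m+1)`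
contains the reversed caps `−capv sg ε δ = capv (−sg) (−ε) δ`.  This is NOT decidable from positions alone (the hole-versus-site separation `ν/√3` is
below the position resolution `≈ 0.75ν` at depth `31`); it IS decided at the τ-SCALE by the exact bond dictionary:

* §1 `downcap_budget` — the one closed numeric input: `(2τ₃₁ + (5/2)·3·10⁻⁴·1.0347ν)·√18 < (399/400)ν` (`0.2085 < 0.9975`); small T3 identities.
* §2 ★ `pair_reverse` — two established sites `j`, `k` in one frame with labels `L`, `L + U`, `U` a model vector of the copy of `j` (`tsq U = 18`): the
  pattern point `u` of `j` charted to `U` points (by `child_position` + `site_eq_of_close`) AT `k`; the exact bond dictionary (`bond_exact`) returns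
  `w₀ ∈ P_k` with `R₁ w₀ = −u`; the composite chart `M_j ∘ R₁` and the chart `M_k` of `k` both fit the frame at `k` (`link_comp`), so they are
  `(τ_k + τ_j + η)/β`-close on `w₀` (`charts_close`); `M_k w₀ = mv W` (`W ∈ C_k`) and `M_j(R₁ w₀) = mv (−U)` are model points `1/√18` apart unless equal
  — hence `−U = W ∈ C_k`.
* §3 ★ `run_caps` — applied along a run (output of `stack_run_box_record`, bounds normalised to `(τ₃₁, D₃₁)` and the window `[0.9026, 1.0347]·ν`): for every
  `m < L` the cap sign `ε_m` satisfies `capv sg ε_m δ ∈ Cs m` AND `capv (−sg) (−ε_m) δ ∈ Cs (m+1)` (`δ ∈ dL`) — the partner pair is the residue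
  representative `x = −3⌊o₁/3⌋·(1,1,−2)` of the level offset `o = offs m` and its cap image.
-/

namespace Summit.AtomisticToContinuum.Crystallization.Theorems.OverbindingBudgetAffineCompressedCutLevels

open Literature.Geometry.DiscreteGeometry (nearestDist nearestDist_nonneg fccTwoShellPattern hcpTwoShellPattern)
open Summit.AtomisticToContinuum.Crystallization.Theorems.OverbindingBudgetAffineCompressedCutKernel (T3 tsub tadd tneg tsq thsum fccL fccNegL hcpL
  hcpAltL capL)
open Summit.AtomisticToContinuum.Crystallization.Theorems.OverbindingBudgetAffineCompressedCutCharts (mv mv_tsub mv_tneg norm_mv_sq norm_mv_eq_one_iff)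
open Summit.AtomisticToContinuum.Crystallization.Theorems.OverbindingBudgetAffineCompressedCutEstablish (Estab site_eq_of_close child_position bond_exact
  link_comp charts_close)
open Summit.AtomisticToContinuum.Crystallization.Theorems.OverbindingBudgetAffineCompressedCutSeed (InLayer)
open Summit.AtomisticToContinuum.Crystallization.Theorems.OverbindingBudgetAffineCompressedCutStack (inLayer_tadd)
open Summit.AtomisticToContinuum.Crystallization.Theorems.OverbindingBudgetAffineCompressedCutPatch (InBox capv dL dL_facts inLayer_capv_sub)
open Summit.AtomisticToContinuum.Crystallization.Theorems.OverbindingBudgetAffineCompressedCutRunBox (column)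
open Summit.AtomisticToContinuum.Crystallization.Theorems.OverbindingBudgetAffineCompressedCutBudget (tauR dR record_numbers)

variable {N : ℕ}

/-! ## §1  The numeric input and small identities -/

/-- ★ **DOWN-CAP BUDGET** (closed numeric lemma): `(2τ₃₁ + (5/2)·3·10⁻⁴·1.0347ν)·√18 < (399/400)ν` — two depth-31 chart errors plus a link, times the
model resolution `√18`, stay below the frame's lower bound (`0.2085 < 0.9975`). [this file] -/
theorem downcap_budget {ν : ℝ} (hν : 0 < ν) :
    (2 * tauR ν 31 + 5 / 2 * (3 / 10 ^ 4 * (10347 / 10000 * ν))) * Real.sqrt 18 < 399 / 400 * ν := by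
  have h18 : Real.sqrt 18 < 4243 / 1000 := by
    rw [Real.sqrt_lt' (by norm_num)]; norm_num
  have h0 : 0 ≤ Real.sqrt 18 := Real.sqrt_nonneg 18
  simp only [tauR]
  push_cast
  nlinarith

/-- The reversed cap: `−capv s ε δ = capv (−s) (−ε) δ`. [this file] -/
theorem tneg_capv (s ε : ℤ) (δ : T3) : tneg (capv s ε δ) = capv (-s) (-ε) δ := by
  simp only [tneg, capv, Prod.mk.injEq]
  exact ⟨by ring, by ring, by ring⟩

/-- Caps are first-shell model vectors: `tsq (capv s ε δ) = 18` for `s, ε = ±1`, `δ ∈ dL`. [this file] -/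
theorem tsq_capv {s ε : ℤ} (hs : s = 1 ∨ s = -1) (hε : ε = 1 ∨ ε = -1) : ∀ δ ∈ dL, tsq (capv s ε δ) = 18 := by
  rcases hs with rfl | rfl <;> rcases hε with rfl | rfl <;> decide

/-- Integer vectors with `tsq (W − V) < 1` are equal. [this file] -/
theorem eq_of_tsq_tsub_lt_one {W V : T3} (h : tsq (tsub W V) < 1) : W = V := by
  obtain ⟨a, b, c⟩ := W
  obtain ⟨d, e, f⟩ := V
  simp only [tsq, tsub] at h
  have ha : (a - d) ^ 2 < 1 := by nlinarith [mul_self_nonneg (b - e), mul_self_nonneg (c - f)]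
  have hb : (b - e) ^ 2 < 1 := by nlinarith [mul_self_nonneg (a - d), mul_self_nonneg (c - f)]
  have hc : (c - f) ^ 2 < 1 := by nlinarith [mul_self_nonneg (a - d), mul_self_nonneg (b - e)]
  have ha' := Int.abs_lt_one_iff.mp ((sq_lt_one_iff_abs_lt_one _).mp ha)
  have hb' := Int.abs_lt_one_iff.mp ((sq_lt_one_iff_abs_lt_one _).mp hb)
  have hc' := Int.abs_lt_one_iff.mp ((sq_lt_one_iff_abs_lt_one _).mp hc)
  simp only [Prod.mk.injEq]
  exact ⟨by linarith, by linarith, by linarith⟩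

/-- The partner-pair label identity: `(column (m+1) + (o + capv 0 ε c₀)) + (x + (capv 0 ε δ − capv 0 ε c₀)) = ((column m + o) + x) + capv sg ε δ`. [this file] -/
theorem pair_label (lam₀ o x δ : T3) (sg ε : ℤ) (m : ℕ) :
    tadd (tadd (column lam₀ sg ((m + 1 : ℕ) : ℤ)) (tadd o (capv 0 ε (1, 1, -2)))) (tadd x (tsub (capv 0 ε δ) (capv 0 ε (1, 1, -2)))) =
      tadd (tadd (tadd (column lam₀ sg (m : ℤ)) o) x) (capv sg ε δ) := by
  simp only [column, tadd, tsub, capv, Prod.mk.injEq]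
  push_cast
  exact ⟨by ring, by ring, by ring⟩

/-! ## §2  Down-cap consistency a posteriori -/

/-- ★★ **PAIR REVERSE.**  In a ball with the record data (radius `r`), frame `B` bounded below by `β > 0`: if `j` is established with chart `M_j` onto
`C_j`, label `L`, bounds `(τ_j, D_j)`, and `k` is established with chart `M_k` onto `C_k`, label `L + U`, bounds `(τ_k, D_k)`, where `U ∈ C_j` is a
first-shell model vector, and the resolutions `D_j + 10⁻⁴ν_j + τ_j + D_k < ν_k` (site identification) and `(τ_k + τ_j + η_{jk})·√18 < β` (chart
identification) hold — then the REVERSED vector `−U` belongs to `C_k`.  (The bond `j → k` along `U` exists and is exact; its dictionary carries `−u` to a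
pattern point of `k`, on which the two charts of `k` — `M_k` and `M_j ∘ R₁` — agree to within `< 1/√18` in model units.) [this file] -/
theorem pair_reverse {y : Fin N → EuclideanSpace ℝ (Fin 3)} (hy : Function.Injective y) {r : ℝ} {i : Fin N}
    {A : Fin N → (EuclideanSpace ℝ (Fin 3) →ₗ[ℝ] EuclideanSpace ℝ (Fin 3))} {Qf : Fin N → (EuclideanSpace ℝ (Fin 3) →ₗᵢ[ℝ] EuclideanSpace ℝ (Fin 3))}
    {P : Fin N → Finset (EuclideanSpace ℝ (Fin 3))} {f : Fin N → EuclideanSpace ℝ (Fin 3) → EuclideanSpace ℝ (Fin 3)}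
    (hP : ∀ j, dist (y j) (y i) ≤ r → (P j = fccTwoShellPattern ∨ P j = hcpTwoShellPattern))
    (hA : ∀ j, dist (y j) (y i) ≤ r → ∀ v ∈ P j, ‖A j v - Qf j v‖ ≤ 1 / 1000)
    (hf : ∀ j, dist (y j) (y i) ≤ r → ∀ v ∈ P j, f j v ∈ Set.range y ∧ dist (f j v) (y j + nearestDist y j • A j v) ≤ 1 / 10 ^ 4 * nearestDist y j)
    (hinj : ∀ j, dist (y j) (y i) ≤ r → Set.InjOn (f j) ↑(P j))
    (hex : ∀ j, dist (y j) (y i) ≤ r → ∀ m, m ≠ j → dist (y m) (y j) ≤ (3 / 2 + 1 / 450) * nearestDist y j → ∃ v ∈ P j, f j v = y m)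
    {B : EuclideanSpace ℝ (Fin 3) →ₗ[ℝ] EuclideanSpace ℝ (Fin 3)} {β : ℝ} (hB : ∀ z, β * ‖z‖ ≤ ‖B z‖) (hβ : 0 < β)
    {j k : Fin N} (hj : dist (y j) (y i) ≤ r) (hk : dist (y k) (y i) ≤ r)
    {Mj Mk : EuclideanSpace ℝ (Fin 3) →ₗᵢ[ℝ] EuclideanSpace ℝ (Fin 3)} {Cj Ck : List T3} {L U : T3} {τj Dj τk Dk : ℝ}
    (hEj : Estab y A P B i j Mj Cj L τj Dj) (hEk : Estab y A P B i k Mk Ck (tadd L U) τk Dk) (hU : U ∈ Cj) (hU18 : tsq U = 18)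
    (hsite : Dj + 1 / 10 ^ 4 * nearestDist y j + τj + Dk < nearestDist y k)
    (hchart : (τk + (τj + 5 / 2 * (2 * (1 / 10 ^ 4) * nearestDist y j + 1 / 10 ^ 4 * nearestDist y k))) * Real.sqrt 18 < β) :
    tneg U ∈ Ck := by
  obtain ⟨u, hu, hMu⟩ := hEj.1.2 U hU
  have hu1 : ‖u‖ = 1 := by rw [← Mj.norm_map u, hMu]; exact (norm_mv_eq_one_iff U).2 hU18
  obtain ⟨⟨n, hn⟩, -⟩ := hf j hj u hu
  have hposn := child_position hEj (hf j hj) hu hu1 hMu hn.symm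
  have hnk : n = k := site_eq_of_close hposn hEk.2.2 hsite
  have hfk : f j u = y k := by rw [← hnk]; exact hn.symm
  obtain ⟨-, -, -, R₁, hop, hED⟩ := bond_exact hy hP hA hf hinj hex hj hk hu hu1 hfk
  obtain ⟨⟨w₀, hw₀, -, hRw₀⟩, -⟩ := hED
  have hl := link_comp hEj.2.1 hop
  have hcl := charts_close hB hEk.2.1 hl w₀
  obtain ⟨W, hW, hMkW⟩ := hEk.1.1 w₀ hw₀
  have hw₀1 : ‖w₀‖ = 1 := by rw [← R₁.norm_map w₀, hRw₀, norm_neg, hu1]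
  have hcomp : (Mj.comp R₁) w₀ = mv (tneg U) := by
    change Mj (R₁ w₀) = _
    rw [hRw₀, Mj.map_neg, hMu, mv_tneg]
  rw [hMkW, hcomp, hw₀1, mul_one, ← mv_tsub] at hcl
  have h18 : 0 < Real.sqrt 18 := by positivity
  have hsq18 : Real.sqrt 18 ^ 2 = 18 := Real.sq_sqrt (by norm_num)
  have hlt : ‖mv (tsub W (tneg U))‖ * Real.sqrt 18 < 1 := by
    have h2 : β * (‖mv (tsub W (tneg U))‖ * Real.sqrt 18) < β * 1 := by
      calc β * (‖mv (tsub W (tneg U))‖ * Real.sqrt 18) = β * ‖mv (tsub W (tneg U))‖ * Real.sqrt 18 := by ring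
        _ ≤ (τk + (τj + 5 / 2 * (2 * (1 / 10 ^ 4) * nearestDist y j + 1 / 10 ^ 4 * nearestDist y k))) * Real.sqrt 18 :=
          mul_le_mul_of_nonneg_right hcl h18.le
        _ < β := hchart
        _ = β * 1 := (mul_one β).symm
    exact lt_of_mul_lt_mul_left h2 hβ.le
  have hsq : tsq (tsub W (tneg U)) < 1 := by
    have hn0 := norm_nonneg (mv (tsub W (tneg U)))
    have h1 : ‖mv (tsub W (tneg U))‖ ^ 2 * 18 < 1 := by nlinarith [mul_nonneg hn0 h18.le]
    rw [norm_mv_sq] at h1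
    have : (tsq (tsub W (tneg U)) : ℝ) < 1 := by linarith
    exact_mod_cast this
  rw [← eq_of_tsq_tsub_lt_one hsq]
  exact hW

/-! ## §3  The caps of a run -/

/-- The offsets of a run are multiples of `(1,1,−2)`: `o₂ = o₁`, `o₃ = −2o₁`. [this file] -/
theorem offs_shape {offs : ℕ → T3} {L : ℕ} (h0 : offs 0 = (0, 0, 0))
    (hstep : ∀ m, m < L → ∃ ε : ℤ, offs (m + 1) = tadd (offs m) (capv 0 ε (1, 1, -2))) :
    ∀ m, m ≤ L → (offs m).2.1 = (offs m).1 ∧ (offs m).2.2 = -2 * (offs m).1 := by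
  intro m
  induction m with
  | zero => intro _; simp [h0]
  | succ m ih =>
    intro hm
    obtain ⟨h1, h2⟩ := ih (Nat.le_of_succ_le hm)
    obtain ⟨ε, hε⟩ := hstep m hm
    rw [hε]
    simp only [tadd, capv]
    constructor <;> linarith

/-- ★★ **THE CAPS OF A RUN.**  A run in the record ball (frame `B` with the lower bound `399/400`, climbing direction `sg`, offsets `offs`, copies `Cs`,
levels `m ≤ L` with `L + 6 ≤ K₀ − …` room in the boxes, every level site normalised to the bounds `(τ₃₁, D₃₁)` and the window `[0.9026, 1.0347]·ν`):
for every `m < L` the step sign `ε_m` of the run satisfies BOTH cap records — `capv sg ε_m δ ∈ Cs m` (up, from the run) and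
`capv (−sg) (−ε_m) δ ∈ Cs (m+1)` (down, by `pair_reverse` on the partner pair at the residue representative of `offs m`). [this file] -/
theorem run_caps {y : Fin N → EuclideanSpace ℝ (Fin 3)} (hy : Function.Injective y) {i : Fin N} (hν : 0 < nearestDist y i)
    {A : Fin N → (EuclideanSpace ℝ (Fin 3) →ₗ[ℝ] EuclideanSpace ℝ (Fin 3))} {Qf : Fin N → (EuclideanSpace ℝ (Fin 3) →ₗᵢ[ℝ] EuclideanSpace ℝ (Fin 3))}
    {P : Fin N → Finset (EuclideanSpace ℝ (Fin 3))} {f : Fin N → EuclideanSpace ℝ (Fin 3) → EuclideanSpace ℝ (Fin 3)}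
    {B : EuclideanSpace ℝ (Fin 3) →ₗ[ℝ] EuclideanSpace ℝ (Fin 3)}
    (hP : ∀ j, dist (y j) (y i) ≤ 12 * nearestDist y i → (P j = fccTwoShellPattern ∨ P j = hcpTwoShellPattern))
    (hA : ∀ j, dist (y j) (y i) ≤ 12 * nearestDist y i → ∀ v ∈ P j, ‖A j v - Qf j v‖ ≤ 1 / 1000)
    (hf : ∀ j, dist (y j) (y i) ≤ 12 * nearestDist y i → ∀ v ∈ P j,
      f j v ∈ Set.range y ∧ dist (f j v) (y j + nearestDist y j • A j v) ≤ 1 / 10 ^ 4 * nearestDist y j)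
    (hinj : ∀ j, dist (y j) (y i) ≤ 12 * nearestDist y i → Set.InjOn (f j) ↑(P j))
    (hex : ∀ j, dist (y j) (y i) ≤ 12 * nearestDist y i → ∀ m, m ≠ j → dist (y m) (y j) ≤ (3 / 2 + 1 / 450) * nearestDist y j →
      ∃ v ∈ P j, f j v = y m)
    (hB : ∀ z, 399 / 400 * nearestDist y i * ‖z‖ ≤ ‖B z‖)
    {sg : ℤ} (hsg : sg = 1 ∨ sg = -1) {lam₀ : T3} {K₀ : ℤ} {L : ℕ} (hL6 : (L : ℤ) + 6 ≤ K₀)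
    {offs : ℕ → T3} {Cs : ℕ → List T3} (h0 : offs 0 = (0, 0, 0))
    (hstep : ∀ m, m < L → ∃ ε : ℤ, (ε = 1 ∨ ε = -1) ∧ (∀ δ ∈ dL, capv sg ε δ ∈ capL (Cs m) sg) ∧
      offs (m + 1) = tadd (offs m) (capv 0 ε (1, 1, -2)))
    (hlev : ∀ m, m ≤ L → ∀ x, InLayer x → InBox (offs m) (K₀ - (m : ℤ)) x →
      ∃ k : Fin N, ∃ M : EuclideanSpace ℝ (Fin 3) →ₗᵢ[ℝ] EuclideanSpace ℝ (Fin 3),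
        dist (y k) (y i) ≤ 12 * nearestDist y i ∧ 9026 / 10000 * nearestDist y i ≤ nearestDist y k ∧
        nearestDist y k ≤ 10347 / 10000 * nearestDist y i ∧
        Estab y A P B i k M (Cs m) (tadd (tadd (column lam₀ sg (m : ℤ)) (offs m)) x) (tauR (nearestDist y i) 31) (dR (nearestDist y i) 31)) :
    ∀ m, m < L → ∃ ε : ℤ, (ε = 1 ∨ ε = -1) ∧ offs (m + 1) = tadd (offs m) (capv 0 ε (1, 1, -2)) ∧
      (∀ δ ∈ dL, capv sg ε δ ∈ Cs m) ∧ (∀ δ ∈ dL, capv (-sg) (-ε) δ ∈ Cs (m + 1)) := by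
  set ν := nearestDist y i with hνdef
  have hshape := offs_shape h0 (fun m hm => by obtain ⟨ε, -, -, h⟩ := hstep m hm; exact ⟨ε, h⟩)
  obtain ⟨-, hres, -, -, -⟩ := record_numbers hν
  have hdc := downcap_budget hν
  have hc₀ : ((1 : ℤ), (1 : ℤ), (-2 : ℤ)) ∈ dL := by decide
  intro m hm
  obtain ⟨ε, hε, hcaps, hoffs⟩ := hstep m hm
  have hcapsC : ∀ δ ∈ dL, capv sg ε δ ∈ Cs m := fun δ hδ => (List.mem_filter.mp (hcaps δ hδ)).1
  refine ⟨ε, hε, hoffs, hcapsC, fun δ hδ => ?_⟩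
  -- the partner pair: `x` the residue representative of `o = offs m`, `x' = x + (capv 0 ε δ − capv 0 ε c₀)`
  obtain ⟨ho2, ho3⟩ := hshape m hm.le
  set o := offs m with hodef
  set t : ℤ := -(3 * (o.1 / 3)) with ht
  have hx : InLayer ((t, t, -2 * t) : T3) := ⟨by simp only; ring, ⟨-(o.1 / 3), by rw [ht]; ring⟩, ⟨-(o.1 / 3), by rw [ht]; ring⟩⟩
  have hto : 0 ≤ t + o.1 ∧ t + o.1 ≤ 2 := by omega
  have hxbox : InBox o (K₀ - (m : ℤ)) (t, t, -2 * t) := by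
    have hlt : (m : ℤ) < L := by exact_mod_cast hm
    have hmL : (m : ℤ) + 7 ≤ K₀ := by linarith
    refine ⟨abs_le.mpr ⟨?_, ?_⟩, abs_le.mpr ⟨?_, ?_⟩, abs_le.mpr ⟨?_, ?_⟩⟩ <;> simp only <;> linarith
  obtain ⟨hδ0, hδ1, hδ2, hδ3⟩ := dL_facts δ hδ
  rw [abs_le] at hδ1 hδ2 hδ3
  have hx' : InLayer (tadd (t, t, -2 * t) (tsub (capv 0 ε δ) (capv 0 ε (1, 1, -2)))) := inLayer_tadd hx (inLayer_capv_sub hε hδ hc₀)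
  have hx'box : InBox (offs (m + 1)) (K₀ - ((m + 1 : ℕ) : ℤ)) (tadd (t, t, -2 * t) (tsub (capv 0 ε δ) (capv 0 ε (1, 1, -2)))) := by
    have hlt : (m : ℤ) + 1 ≤ L := by exact_mod_cast hm
    have hmL : ((m + 1 : ℕ) : ℤ) + 6 ≤ K₀ := by push_cast; linarith
    rw [hoffs]
    rcases hε with rfl | rfl <;>
      refine ⟨abs_le.mpr ⟨?_, ?_⟩, abs_le.mpr ⟨?_, ?_⟩, abs_le.mpr ⟨?_, ?_⟩⟩ <;> simp only [tadd, tsub, capv] <;> linarith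
  obtain ⟨j, Mj, hjr, hjlo, hjhi, hEj⟩ := hlev m hm.le _ hx hxbox
  obtain ⟨k, Mk, hkr, hklo, hkhi, hEk⟩ := hlev (m + 1) hm _ hx' hx'box
  rw [hoffs, pair_label] at hEk
  have hU18 : tsq (capv sg ε δ) = 18 := tsq_capv hsg hε δ hδ
  have hsite : dR ν 31 + 1 / 10 ^ 4 * nearestDist y j + tauR ν 31 + dR ν 31 < nearestDist y k := by nlinarith
  have hchart : (tauR ν 31 + (tauR ν 31 + 5 / 2 * (2 * (1 / 10 ^ 4) * nearestDist y j + 1 / 10 ^ 4 * nearestDist y k))) * Real.sqrt 18 <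
      399 / 400 * ν := by
    have h18 : 0 ≤ Real.sqrt 18 := Real.sqrt_nonneg 18
    have hle : tauR ν 31 + (tauR ν 31 + 5 / 2 * (2 * (1 / 10 ^ 4) * nearestDist y j + 1 / 10 ^ 4 * nearestDist y k)) ≤
        2 * tauR ν 31 + 5 / 2 * (3 / 10 ^ 4 * (10347 / 10000 * ν)) := by linarith
    exact (mul_le_mul_of_nonneg_right hle h18).trans_lt hdc
  have hrev := pair_reverse hy hP hA hf hinj hex hB (by positivity) hjr hkr hEj hEk (hcapsC δ hδ) hU18 hsite hchart
  rwa [tneg_capv] at hrev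

end Summit.AtomisticToContinuum.Crystallization.Theorems.OverbindingBudgetAffineCompressedCutLevels
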